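import Literature.AnabelianGeometry.AbsoluteAnabelian.GaloisPadicLogPowers
import Literature.Algebra.Module.PadicAdditiveMapsLinear
import Literature.IUT.LogVolume.PadicSubfields
import Literature.IUT.LogVolume.LogShellTopology
import Mathlib.FieldTheory.Galois.Infinite
import HarnessLib

/-!
# The lattices `Im((𝒪_k̄^×)^H) ⊆ k~` are `ℤ_p`-stable and, for `H` open, `p`-adically separated;
# every group endomorphism of `k~` respecting them commutes with the `ℤ_p^×`-powers (proof-only)

S. Mochizuki, *Inter-universal Teichmüller theory II*, §1, Example 1.8 (iv), kurims manuscript (Dec. 2020) p. 39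
[claim: Mochizuki2012, status: disputed] (IUTchII §1 Ex 1.8 (iv), kurims p.39): "`Ism(G)` … `G`-isometries of
`O^{×μ}(G)` … that, for each open subgroup `H ⊆ G`, preserve the lattice in `O^{×μ}(G)^H` determined by the image of
`O^×(G)^H`", "another example of such a `Γ^{×μ}` [i.e. a closed subgroup of `Ism(−)` PRESERVED BY ARBITRARY
ISOMORPHISMS `G₁ ⥲ G₂`] is the image `Im(Ẑ^×)` of the natural homomorphism `Ẑ^× ↠ ℤ_p^× ↪ Ism`"; and
S. Mochizuki, *Topics in absolute anabelian geometry III*, §3, proof of Prop. 3.3 (ii), kurims p. 74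
[MochizukiAbsTopIII2015] ("natural action of `Ẑ^×` on `M = 𝒪_k̄^×`").  abc-iut cell, layer L6, row «ZHAT-NAT»
(abc-iut-w6-d011 07:06Z offer; abc-iut-L6-d2 07:59Z kit); seat abc-iut-w6-d104.  PROOF-ONLY over
abc-iut-L6-d2's `GaloisPadicLogPowers.lean` (`MLFClosure.zpPow`, `padicScalar`, the lattice lemma) and the
classical brick `Literature/Algebra/Module/PadicAdditiveMapsLinear.lean` (additive maps into `p`-adically separated
`ℤ_p`-modules are `ℤ_p`-linear).

For an `MLFClosure` `C = (k, k̄)`, `k~ := 𝒪_k̄^× ⧸ 𝒪_k̄^μ`, `log_k̄ : k~ ⥲ (k̄, +)` and a subgroup `H ⊆ Gal(k̄/k)`,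
write `Λ_H ⊆ k~` for the image of the `H`-fixed units `(𝒪_k̄^×)^H`.

* `MLFClosure.exists_fixed_log_eq_padicScalar_mul` — **`Λ_H` is `ℤ_p`-stable** (for ALL `a ∈ ℤ_p`, not only
  units: for `u` fixed by `H` there is `v` fixed by `H` with `log_k̄ v = a · log_k̄ u`; the lattice lemma
  `exists_mem_adjoin_unit_log_eq_mul` verbatim);
* `MLFClosure.log_eq_zero_of_forall_exists_fixed` — **for `H` OPEN, `Λ_H` is `p`-ADICALLY SEPARATED**: an
  element of `k̄` of the form `p^n · log_k̄ w_n` with `w_n ∈ (𝒪_k̄^×)^H` for EVERY `n` is `0`.  Proof: the fixed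
  field `L := k̄^H` is finite over `k` (Mathlib's infinite Galois correspondence: `InfiniteGalois.isOpen_iff_finite`);
  along the model identification `k̄ ≃ ℚ̄_p` through which `log_k̄` is DEFINED, `log_k̄((𝒪_k̄^×)^H)` lands in
  abc-iut-S1's `log_p(𝒪_E^×)` of the finite `E = image of L ⊆ ℚ̄_p`, which is COMPACT (`isCompact_logUnits`), hence
  bounded, and `‖p^n · (bounded)‖ → 0`;
* `MLFClosure.map_zpPow_eq_of_mapsTo_fixed` — **any group endomorphism `T` of `k~` carrying `Λ_H` into `Λ_{H'}`
  with `H'` open commutes with every `ℤ_p^×`-power on `Λ_H`**: through `log_k̄`, `T` is an additive map from the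
  `ℤ_p`-module `log_k̄(Λ_H)` into the `p`-adically separated `ℤ_p`-module `log_k̄(Λ_{H'})`, hence `ℤ_p`-LINEAR
  (`PadicAdditiveLinear.map_smul_of_iInf_pow_smul_top_eq_bot`) — no continuity or `ℚ_p`-linearity of `T` is assumed.

The consumer is the naturality of `Ẑ^× ↠ ℤ_p^× ↪ Ism(G)` under the lifted transports `liftM(φ)` of the genuine
[IUTchII] Ex. 1.8 producer (`AbsTopMonoidsGenuineZhatNaturality.lean`).  HONEST FRAMING: classical `p`-adic analysis
and Galois theory; record-anchored to a disputed corpus only through the locators; nothing here bears on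
[IUTchIII] Cor. 3.12.
-/

set_option autoImplicit false

noncomputable section

namespace Literature.AnabelianGeometry.AbsoluteAnabelian

open ValuativeRel
open scoped ValuativeRel
open Literature.NumberTheory.Transcendental Literature.NumberTheory.GaloisRepresentations
open Literature.IUT.LogVolume
open scoped Literature.IUT.LogVolume

namespace MLFClosure

variable (C : MLFClosure.{0})

/-! ## `Λ_H` is `ℤ_p`-stable (all of `ℤ_p`) -/

section Stable

variable [Fact C.residueChar.Prime]

/-- **The lattice `Im((𝒪_k̄^×)^H)` is a `ℤ_p`-submodule of `k~ ≅ (k̄, +)`**: for every subgroup `H ⊆ Gal(k̄/k)`,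
every `u ∈ 𝒪_k̄^×` fixed by `H` and every `a ∈ ℤ_p` there is `v ∈ 𝒪_k̄^×` fixed by `H` with
`log_k̄ v = a · log_k̄ u` (the lattice lemma `exists_mem_adjoin_unit_log_eq_mul`: take `v ∈ k(u) ⊆ k̄^H`).
[cite: MochizukiAbsTopIII2015, Proposition 3.3 (ii) p.74] -/
theorem exists_fixed_log_eq_padicScalar_mul (H : Subgroup (C.K ≃ₐ[C.k] C.K)) (u : unitGroup C.k C.K)
    (hu : ∀ σ ∈ H, σ ((u : (C.K)ˣ) : C.K) = ((u : (C.K)ˣ) : C.K)) (a : ℤ_[C.residueChar]) :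
    ∃ v : unitGroup C.k C.K, (∀ σ ∈ H, σ ((v : (C.K)ˣ) : C.K) = ((v : (C.K)ˣ) : C.K)) ∧
      C.galoisPadicLog.log ((v : (C.K)ˣ) : C.K) = C.padicScalar a * C.galoisPadicLog.log ((u : (C.K)ˣ) : C.K) := by
  obtain ⟨y, hyF, hyu, hylog⟩ := C.exists_mem_adjoin_unit_log_eq_mul u.2 a
  obtain ⟨v, hv⟩ := exists_unitGroup_val_eq hyu
  have hFle : IntermediateField.adjoin C.k ({((u : (C.K)ˣ) : C.K)} : Set C.K) ≤ IntermediateField.fixedField H := by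
    rw [IntermediateField.adjoin_simple_le_iff]
    exact fun σ => hu σ σ.2
  refine ⟨v, fun σ hσ => ?_, ?_⟩
  · rw [hv]
    exact (IntermediateField.mem_fixedField_iff H y).mp (hFle hyF) σ hσ
  · rw [hv, hylog, padicScalar_apply]

end Stable

/-! ## For `H` open, `Λ_H` is `p`-adically separated -/

section Separated

variable (p : ℕ) [hp : Fact p.Prime]

/-- **Separatedness at a residue characteristic `p`** (the analytic core, for the logarithm
`galoisPadicLogOfResidueChar p`): if `H ⊆ Gal(k̄/k)` is OPEN and `z ∈ k̄` can be written `z = p^n · log_k̄ w_n` with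
`w_n ∈ 𝒪_k̄^×` fixed by `H` for every `n`, then `z = 0`.  The fixed field `k̄^H` is finite over `k` (infinite
Galois correspondence); along the identification `k̄ ≃ ℚ̄_p` the values `log_k̄ w_n` lie in the compact — hence
bounded — set `log_p(𝒪_E^×)` of the finite `E ⊆ ℚ̄_p` corresponding to `k̄^H` (abc-iut-S1 `isCompact_logUnits`,
`coe_unitLog_eq_padicLogAlgCl`), so `‖z‖ ≤ p^{-n} · B` for all `n`. [cite: MochizukiAbsTopIII2015, Proposition 3.3 (ii) p.74] -/
theorem log_eq_zero_of_forall_exists_fixed_ofResidueChar (hpk : valuation C.k p < 1)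
    (H : Subgroup (C.K ≃ₐ[C.k] C.K)) (hH : IsOpen (H : Set (C.K ≃ₐ[C.k] C.K))) {z : C.K}
    (hz : ∀ n : ℕ, ∃ w : unitGroup C.k C.K, (∀ σ ∈ H, σ ((w : (C.K)ˣ) : C.K) = ((w : (C.K)ˣ) : C.K)) ∧
      z = (p : C.K) ^ n * (C.galoisPadicLogOfResidueChar p hpk).log ((w : (C.K)ˣ) : C.K)) :
    z = 0 := by
  letI iQk : Algebra ℚ_[p] C.k := LocalField.padicAlgebra C.k p hpk
  letI iQK : Algebra ℚ_[p] C.K := ((algebraMap C.k C.K).comp (LocalField.padicRingHom C.k p hpk)).toAlgebra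
  haveI : IsScalarTower ℚ_[p] C.k C.K := IsScalarTower.of_algebraMap_eq fun _ => rfl
  haveI : FiniteDimensional ℚ_[p] C.k :=
    Literature.NumberTheory.PAdicHodge.PadicBase.instFiniteDimensional (F := C.k) (p := p) hpk
  haveI : IsAlgClosure ℚ_[p] C.K :=
    { isAlgClosed := IsAlgClosure.isAlgClosed C.k
      isAlgebraic := C.isAlgebraic_padic_K p hpk }
  let e : C.K ≃ₐ[ℚ_[p]] PadicAlgCl p := IsAlgClosure.equiv ℚ_[p] C.K (PadicAlgCl p)
  letI ikA : Algebra C.k (PadicAlgCl p) := (e.toAlgHom.toRingHom.comp (algebraMap C.k C.K)).toAlgebra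
  haveI hST : IsScalarTower ℚ_[p] C.k (PadicAlgCl p) := IsScalarTower.of_algebraMap_eq fun c => by
    change algebraMap ℚ_[p] (PadicAlgCl p) c = e (algebraMap C.k C.K (algebraMap ℚ_[p] C.k c))
    rw [← IsScalarTower.algebraMap_apply ℚ_[p] C.k C.K, AlgEquiv.commutes]
  let e' : C.K ≃ₐ[C.k] PadicAlgCl p :=
    { e.toRingEquiv with commutes' := fun _ => rfl }
  -- the logarithm of `galoisPadicLogOfResidueChar` is, by definition, the transport of `padicLogAlgCl` along `e'`
  have hlog : ∀ x : C.K, (C.galoisPadicLogOfResidueChar p hpk).log x = e'.symm (padicLogAlgCl p (e' x)) :=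
    fun _ => rfl
  -- the fixed field of the open subgroup `H` is finite over `k`
  haveI : IsGalois C.k C.K := {}
  set L : IntermediateField C.k C.K := IntermediateField.fixedField H with hL
  have hHc : IsClosed (H : Set (C.K ≃ₐ[C.k] C.K)) := Subgroup.isClosed_of_isOpen H hH
  have hfix : L.fixingSubgroup = H := InfiniteGalois.fixingSubgroup_fixedField ⟨H, hHc⟩
  haveI hLfin : FiniteDimensional C.k L := by
    refine (InfiniteGalois.isOpen_iff_finite L).mp ?_
    change IsOpen (L.fixingSubgroup : Set (C.K ≃ₐ[C.k] C.K))
    rw [hfix]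
    exact hH
  -- its image `E ⊆ ℚ̄_p`, a finite extension of `ℚ_p`
  set X : IntermediateField C.k (PadicAlgCl p) := L.map e'.toAlgHom with hX
  haveI : FiniteDimensional C.k X :=
    LinearEquiv.finiteDimensional (IntermediateField.intermediateFieldMap e' L).toLinearEquiv
  haveI hXQ : FiniteDimensional ℚ_[p] X := Module.Finite.trans C.k X
  set E : IntermediateField ℚ_[p] (PadicAlgCl p) := X.restrictScalars ℚ_[p] with hE
  haveI : FiniteDimensional ℚ_[p] E := hXQ
  -- `log_p(𝒪_E^×)` is compact, hence bounded
  obtain ⟨B, hB⟩ := ((isCompact_logUnits p E).isBounded).exists_norm_le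
  -- every `H`-fixed unit `w` has `‖padicLogAlgCl (e' w)‖ ≤ B`
  have hbound : ∀ w : unitGroup C.k C.K, (∀ σ ∈ H, σ ((w : (C.K)ˣ) : C.K) = ((w : (C.K)ˣ) : C.K)) →
      ‖padicLogAlgCl p (e' ((w : (C.K)ˣ) : C.K))‖ ≤ B := by
    intro w hw
    have hwL : ((w : (C.K)ˣ) : C.K) ∈ L := (IntermediateField.mem_fixedField_iff H _).mpr hw
    have hwE : e' ((w : (C.K)ˣ) : C.K) ∈ E := by
      rw [hE, IntermediateField.mem_restrictScalars, hX, IntermediateField.mem_map]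
      exact ⟨_, hwL, rfl⟩
    have hwu : e' ((w : (C.K)ˣ) : C.K) ∈ unitSubmonoid C.k (PadicAlgCl p) :=
      (mem_unitSubmonoid_algEquiv_iff e' _).mpr w.2
    have hwn : ‖e' ((w : (C.K)ˣ) : C.K)‖ = 1 :=
      (mem_unitSubmonoid_iff_norm_eq_one_of_isNonarchimedeanLocalField p _).mp hwu
    set w' : E := ⟨e' ((w : (C.K)ˣ) : C.K), hwE⟩ with hw'
    have hw'n : ‖w'‖ = 1 := hwn
    have hmem : (unitLog w' : E) ∈ logUnits E := unitLog_mem_logUnits hw'n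
    have h1 := hB _ hmem
    have h2 : ((unitLog w' : E) : PadicAlgCl p) = padicLogAlgCl p (e' ((w : (C.K)ˣ) : C.K)) :=
      coe_unitLog_eq_padicLogAlgCl p E hw'n
    rw [← h2]
    exact h1
  -- `‖e' z‖ ≤ p^{-n} · B` for every `n`
  have hp1 : (1 : ℝ) < p := by exact_mod_cast hp.out.one_lt
  have hnp : ‖(p : PadicAlgCl p)‖ = (p : ℝ)⁻¹ := by
    rw [← map_natCast (algebraMap ℚ_[p] (PadicAlgCl p)) p, norm_algebraMap', Padic.norm_p]
  have hzn : ∀ n : ℕ, ‖e' z‖ ≤ ((p : ℝ)⁻¹) ^ n * B := by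
    intro n
    obtain ⟨w, hw, hzw⟩ := hz n
    rw [hzw, map_mul, map_pow, map_natCast, hlog, AlgEquiv.apply_symm_apply, norm_mul, norm_pow, hnp]
    exact mul_le_mul_of_nonneg_left (hbound w hw) (pow_nonneg (inv_nonneg.mpr (by positivity)) n)
  -- hence `e' z = 0`
  have hB0 : 0 ≤ B := by
    obtain ⟨w, hw, -⟩ := hz 0
    exact (norm_nonneg _).trans (hbound w hw)
  have hez : e' z = 0 := by
    by_contra hne
    have hpos : 0 < ‖e' z‖ := norm_pos_iff.mpr hne
    have hlt1 : (p : ℝ)⁻¹ < 1 := inv_lt_one_of_one_lt₀ hp1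
    obtain ⟨n, hn⟩ := exists_pow_lt_of_lt_one (div_pos hpos (lt_of_le_of_lt hB0 (lt_add_one B))) hlt1
    have h := hzn n
    have hB1 : ((p : ℝ)⁻¹) ^ n * B ≤ ((p : ℝ)⁻¹) ^ n * (B + 1) :=
      mul_le_mul_of_nonneg_left (le_add_of_nonneg_right zero_le_one) (pow_nonneg (inv_nonneg.mpr (by positivity)) n)
    have : ((p : ℝ)⁻¹) ^ n * (B + 1) < ‖e' z‖ := by
      have hB1pos : 0 < B + 1 := lt_of_le_of_lt hB0 (lt_add_one B)
      calc ((p : ℝ)⁻¹) ^ n * (B + 1) < ‖e' z‖ / (B + 1) * (B + 1) := mul_lt_mul_of_pos_right hn hB1pos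
        _ = ‖e' z‖ := div_mul_cancel₀ _ hB1pos.ne'
    linarith
  simpa using congrArg e'.symm hez

variable [Fact C.residueChar.Prime]

/-- **For `H ⊆ Gal(k̄/k)` OPEN, the lattice `Im((𝒪_k̄^×)^H) ⊆ k~` is `p`-adically separated** (for THE logarithm
`log_k̄ = MLFClosure.galoisPadicLog`, `p` the residue characteristic): `z = p^n · log_k̄ w_n` with `w_n` an `H`-fixed
unit for every `n` forces `z = 0`. [cite: MochizukiAbsTopIII2015, Proposition 3.3 (ii) p.74] -/
theorem log_eq_zero_of_forall_exists_fixed (H : Subgroup (C.K ≃ₐ[C.k] C.K))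
    (hH : IsOpen (H : Set (C.K ≃ₐ[C.k] C.K))) {z : C.K}
    (hz : ∀ n : ℕ, ∃ w : unitGroup C.k C.K, (∀ σ ∈ H, σ ((w : (C.K)ˣ) : C.K) = ((w : (C.K)ˣ) : C.K)) ∧
      z = (C.residueChar : C.K) ^ n * C.galoisPadicLog.log ((w : (C.K)ˣ) : C.K)) :
    z = 0 :=
  C.log_eq_zero_of_forall_exists_fixed_ofResidueChar C.residueChar C.valuation_ringChar_lt_one H hH hz

end Separated

/-! ## Group endomorphisms of `k~` respecting the lattices commute with the `ℤ_p^×`-powers -/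

section Linear

variable [Fact C.residueChar.Prime]

omit [Fact C.residueChar.Prime] in
/-- `log_k̄ 1 = 0`. [cite: MochizukiAbsTopIII2015, Definition 3.1 (i) p.66] -/
theorem log_one_eq_zero : C.galoisPadicLog.log (1 : C.K) = 0 := by
  have h := C.galoisPadicLog.log_mul 1 (unitSubmonoid C.k C.K).one_mem 1 (unitSubmonoid C.k C.K).one_mem
  rw [mul_one] at h
  exact left_eq_add.mp h

/-- The `ℤ_p`-submodule `log_k̄(Λ_H) ⊆ k̄` — the logarithms of the `H`-fixed units — for the `ℤ_p`-module
structure `a • z := padicScalar a * z` on `k̄` (used only inside proofs). [cite: MochizukiAbsTopIII2015, Proposition 3.3 (ii) p.74] -/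
theorem exists_logLattice (H : Subgroup (C.K ≃ₐ[C.k] C.K)) :
    letI : Module ℤ_[C.residueChar] C.K := Module.compHom C.K C.padicScalar
    ∃ Λ : Submodule ℤ_[C.residueChar] C.K, ∀ z : C.K, z ∈ Λ ↔
      ∃ w : unitGroup C.k C.K, (∀ σ ∈ H, σ ((w : (C.K)ˣ) : C.K) = ((w : (C.K)ˣ) : C.K)) ∧
        z = C.galoisPadicLog.log ((w : (C.K)ˣ) : C.K) := by
  letI : Module ℤ_[C.residueChar] C.K := Module.compHom C.K C.padicScalar
  let S : Set C.K := fun z => ∃ w : unitGroup C.k C.K,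
    (∀ σ ∈ H, σ ((w : (C.K)ˣ) : C.K) = ((w : (C.K)ˣ) : C.K)) ∧ z = C.galoisPadicLog.log ((w : (C.K)ˣ) : C.K)
  have hadd : ∀ {x y : C.K}, x ∈ S → y ∈ S → x + y ∈ S := by
    rintro _ _ ⟨w₁, hw₁, rfl⟩ ⟨w₂, hw₂, rfl⟩
    refine ⟨w₁ * w₂, fun σ hσ => ?_, ?_⟩
    · change σ (((w₁ : (C.K)ˣ) : C.K) * ((w₂ : (C.K)ˣ) : C.K)) = ((w₁ : (C.K)ˣ) : C.K) * ((w₂ : (C.K)ˣ) : C.K)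
      rw [map_mul, hw₁ σ hσ, hw₂ σ hσ]
    · change _ = C.galoisPadicLog.log (((w₁ : (C.K)ˣ) : C.K) * ((w₂ : (C.K)ˣ) : C.K))
      rw [C.galoisPadicLog.log_mul _ w₁.2 _ w₂.2]
  have hzero : (0 : C.K) ∈ S := ⟨1, fun σ _ => by simp, by simpa using (C.log_one_eq_zero).symm⟩
  have hsmulS : ∀ (a : ℤ_[C.residueChar]) {x : C.K}, x ∈ S → a • x ∈ S := by
    rintro a _ ⟨w, hw, rfl⟩
    obtain ⟨v, hv, hvlog⟩ := C.exists_fixed_log_eq_padicScalar_mul H w hw a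
    exact ⟨v, hv, hvlog.symm⟩
  exact ⟨{ carrier := S, add_mem' := hadd, zero_mem' := hzero, smul_mem' := hsmulS }, fun z => Iff.rfl⟩

/-- **Any group endomorphism `T` of `k~` carrying the lattice of `H` into the lattice of an OPEN `H'` commutes
with every `ℤ_p^×`-power on the lattice of `H`.**  Through `log_k̄`, `T` induces an ADDITIVE map from the
`ℤ_p`-module `log_k̄(Λ_H)` (`exists_fixed_log_eq_padicScalar_mul`) into the `p`-adically SEPARATED `ℤ_p`-module
`log_k̄(Λ_{H'})` (`log_eq_zero_of_forall_exists_fixed`); such a map is `ℤ_p`-linear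
(`PadicAdditiveLinear.map_smul_of_iInf_pow_smul_top_eq_bot`, Fuchs's `Hom(J_p, J_p) = J_p` argument) — no
continuity or `ℚ_p`-linearity of `T` is assumed.  This is the mechanism behind "`Im(Ẑ^× ↠ ℤ_p^× ↪ Ism)` is
preserved by arbitrary isomorphisms". [claim: Mochizuki2012, status: disputed] (IUTchII §1 Ex 1.8 (iv), kurims p.39) -/
theorem map_zpPow_eq_of_mapsTo_fixed
    (T : (unitGroup C.k C.K ⧸ CommGroup.torsion (unitGroup C.k C.K)) →*
      (unitGroup C.k C.K ⧸ CommGroup.torsion (unitGroup C.k C.K)))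
    (H H' : Subgroup (C.K ≃ₐ[C.k] C.K)) (hH' : IsOpen (H' : Set (C.K ≃ₐ[C.k] C.K)))
    (hT : ∀ u : unitGroup C.k C.K, (∀ σ ∈ H, σ ((u : (C.K)ˣ) : C.K) = ((u : (C.K)ˣ) : C.K)) →
      ∃ v : unitGroup C.k C.K, (∀ σ ∈ H', σ ((v : (C.K)ˣ) : C.K) = ((v : (C.K)ˣ) : C.K)) ∧
        T (QuotientGroup.mk u) = QuotientGroup.mk v)
    (u : unitGroup C.k C.K) (hu : ∀ σ ∈ H, σ ((u : (C.K)ˣ) : C.K) = ((u : (C.K)ˣ) : C.K))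
    (a : ℤ_[C.residueChar]ˣ) :
    T (C.zpPow a (QuotientGroup.mk u)) = C.zpPow a (T (QuotientGroup.mk u)) := by
  letI : Module ℤ_[C.residueChar] C.K := Module.compHom C.K C.padicScalar
  have hsmul : ∀ (c : ℤ_[C.residueChar]) (z : C.K), c • z = C.padicScalar c * z := fun _ _ => rfl
  -- the additive avatar `τ` of `T` through `log_k̄`
  let τ : C.K →+ C.K :=
    { toFun := fun z => Multiplicative.toAdd (C.logEquiv (T (C.logEquiv.symm (Multiplicative.ofAdd z))))
      map_zero' := by simp
      map_add' := fun x y => by simp [ofAdd_add, map_mul, toAdd_mul] }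
  have hτ : ∀ y, Multiplicative.toAdd (C.logEquiv (T y)) = τ (Multiplicative.toAdd (C.logEquiv y)) := by
    intro y
    change _ = Multiplicative.toAdd (C.logEquiv (T (C.logEquiv.symm (Multiplicative.ofAdd
      (Multiplicative.toAdd (C.logEquiv y))))))
    rw [ofAdd_toAdd, MulEquiv.symm_apply_apply]
  have hτmk : ∀ w : unitGroup C.k C.K,
      τ (C.galoisPadicLog.log ((w : (C.K)ˣ) : C.K)) = Multiplicative.toAdd (C.logEquiv (T (QuotientGroup.mk w))) := by
    intro w
    rw [hτ, logEquiv_mk, toAdd_ofAdd]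
  -- the two lattices
  obtain ⟨Λ, hΛ⟩ := C.exists_logLattice H
  obtain ⟨Λ', hΛ'⟩ := C.exists_logLattice H'
  -- `τ` restricted: `Λ →+ Λ'`
  have hmaps : ∀ z ∈ Λ, τ z ∈ Λ' := by
    intro z hz
    obtain ⟨w, hw, rfl⟩ := (hΛ z).mp hz
    obtain ⟨v, hv, hTv⟩ := hT w hw
    refine (hΛ' _).mpr ⟨v, hv, ?_⟩
    rw [hτmk, hTv, logEquiv_mk, toAdd_ofAdd]
  let f : Λ →+ Λ' :=
    { toFun := fun z => ⟨τ z, hmaps z z.2⟩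
      map_zero' := Subtype.ext (by simp)
      map_add' := fun x y => Subtype.ext (by simp) }
  -- `Λ'` is `p`-adically separated
  have hN : (⨅ k : ℕ, (Ideal.span {(C.residueChar : ℤ_[C.residueChar])}) ^ k • ⊤ :
      Submodule ℤ_[C.residueChar] Λ') = ⊥ := by
    rw [eq_bot_iff]
    intro n hn
    rw [Submodule.mem_bot]
    apply Subtype.ext
    refine C.log_eq_zero_of_forall_exists_fixed H' hH' (z := (n : C.K)) fun k => ?_
    have hk := (Submodule.mem_iInf _).mp hn k
    rw [Ideal.span_singleton_pow, Submodule.ideal_span_singleton_smul, Submodule.mem_smul_pointwise_iff_exists] at hk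
    obtain ⟨m, -, hm⟩ := hk
    obtain ⟨w, hw, hmw⟩ := (hΛ' _).mp m.2
    refine ⟨w, hw, ?_⟩
    rw [← hm]
    change C.padicScalar ((C.residueChar : ℤ_[C.residueChar]) ^ k) * (m : C.K) = _
    rw [map_pow, map_natCast, hmw]
  -- automatic `ℤ_p`-linearity of `f`
  have hlin := Literature.Algebra.Module.PadicAdditiveLinear.map_smul_of_iInf_pow_smul_top_eq_bot hN f
    (a : ℤ_[C.residueChar]) ⟨C.galoisPadicLog.log ((u : (C.K)ˣ) : C.K), (hΛ _).mpr ⟨u, hu, rfl⟩⟩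
  have hlin' : τ (C.padicScalar a * C.galoisPadicLog.log ((u : (C.K)ˣ) : C.K)) =
      C.padicScalar a * τ (C.galoisPadicLog.log ((u : (C.K)ˣ) : C.K)) :=
    congrArg Subtype.val hlin
  -- back to `k~`
  apply C.logEquiv.injective
  apply Multiplicative.toAdd.injective
  rw [hτ, toAdd_logEquiv_zpPow, logEquiv_mk, toAdd_ofAdd, toAdd_logEquiv_zpPow, ← hτmk]
  exact hlin'

end Linear

end MLFClosure

end Literature.AnabelianGeometry.AbsoluteAnabelian

end
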